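import Mathlib
import Summits.ValiantsHypothesis.ValiantsHypothesis.Theorems.RigidityForcesSymmetryRankRigidMinimalReprLaplaceResidualCaseTwoKernel
import Summits.ValiantsHypothesis.ValiantsHypothesis.Theorems.RigidityForcesSymmetryRankRigidMinimalReprLaplaceResidualReduction
import Summits.ValiantsHypothesis.ValiantsHypothesis.Theorems.RigidityForcesSymmetryRankRigidMinimalReprLaplaceResidualTools
import Summits.ValiantsHypothesis.ValiantsHypothesis.Theorems.RigidityForcesSymmetryRankRigidMinimalReprLaplaceFiveCoreCertified

/-!
# `LaplaceOptimalFive`, the residual configurations: CASE 2 (the slice vector at slot `0` is a letter indicator)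
# (crux `RankRigidMinimalRepr`, stmt-ValiantsHypothesis-18034; frontier rung `LaplaceOptimalFive`, stmt-24813)

Complement of the CASE-1 files of val-lit-p8 g11 (`…LaplaceResidualCase1.lean`: `triangle_case1`, `outside_case1`;
`…LaplaceResidualCase1Leaf.lean`: `outside_leaf_case1`), which refute the residual sorted labelled configurations
`(0; 01,02,12)`, `(0; 01,02,34)`, `(0; 01,12,34)` of `laplace_five_three_slices_residual` whenever the slice vector `α 0` at
slot `0` admits an orthogonal covector with ALL coordinates non-zero (i.e. `α 0` is `0` or has at least two non-zero letters,
`exists_fullSupport_orthogonal`, val-port-2 p616517).  THIS FILE does the remaining case — `α 0` is a LETTER INDICATOR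
`κ·e_a` (exactly one non-zero coordinate) — for the same three configurations: `triangle_case2`, `outside_case2`,
`outside_leaf_case2`.  Together each pair `(…_case1, …_case2)` refutes its configuration outright (the split is on `α 0` alone;
no slot symmetry is needed).

Dual witness (CASE 2 of the blueprint, evidence note NOTE-p8g11-24813 §v3, made unconditional by this seat's kernel lemmas):
`φ₀ := 𝟙 − e_a` (orthogonal to `κ·e_a`, `indicator_orthogonal`); `φ₁ ∈ V₁ = {⊥ α 1, ⊥ μ₁(φ₀)}` chosen by
`caseTwo_exists_phi1` (p617182) so that the kernel of `φ₂ ↦ F(φ₀,φ₁,φ₂)` is at most a line; `φ₂` by val-port-2's REDUCTION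
`exists_orthogonal_not_proportional` (p6168xx, `…LaplaceResidualReduction.lean`): inside `V₂ = {⊥ α 2, ⊥ μ₂}` some `φ₂` has
two-slot form `M = F(φ₀,φ₁,φ₂) ∉ ℂ·N`; `φ₃, φ₄` by LEMMA C (`bilinear_proportional`, p614067) with `φ₃ᵀ N φ₄ = 0 ≠ φ₃ᵀ M φ₄ =
per(φ)` (`permanent_two_slot`); `LaplaceFiveSlices.refute_of_kills` (p609790) concludes.  The kill bookkeeping (cuts, charged
slots, constraint vectors `μ₁, μ₂, N`) is VERBATIM that of the corresponding CASE-1 theorem.  No definitions.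
Seat val-lit-p3 g14 (second hand under val-port-2's cut; val-lit desk RULINGS #260 (c) / #263 (c)).

HONEST FRAMING: exact partial results toward the frontier rung `LaplaceOptimalFive` (stmt-24813), which stays OPEN (the fourth
configuration `(0; 02,12,34)` and the assembly of `hres` remain); nothing here bears on `VP ≠ VNP`, which is NOT proved.
-/

set_option autoImplicit false

-- the mandated summit-side namespace repeats a component by design (single-problem summit)
set_option linter.dupNamespace false

namespace Summit.ValiantsHypothesis.ValiantsHypothesis.Theorems.RigidityForcesSymmetryRankRigidMinimalRepr

namespace LaplaceResidual

open Finset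

/-- **The triangle configuration `(0; 01, 02, 12)`, CASE 2.**  Slices `α_k(v_k) W_k(v)` on slots `0,1,2` and pair terms on
the cuts `{0,1}, {0,2}, {1,2}` never sum to the `5 × 5` permutation pattern, provided the slice vector at slot `0` is a
letter indicator (exactly one non-zero coordinate). [folklore] -/
theorem triangle_case2 (α : Fin 3 → Fin 5 → ℂ) (W : Fin 3 → (Fin 5 → Fin 5) → ℂ)
    (hW : ∀ k, ∀ v v' : Fin 5 → Fin 5, (∀ j, j ≠ (![0, 1, 2] : Fin 3 → Fin 5) k → v j = v' j) → W k v = W k v')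
    (u w : Fin 3 → (Fin 5 → Fin 5) → ℂ)
    (hu : ∀ t, ∀ v v' : Fin 5 → Fin 5, v ((![0, 0, 1] : Fin 3 → Fin 5) t) = v' ((![0, 0, 1] : Fin 3 → Fin 5) t) →
      v ((![1, 2, 2] : Fin 3 → Fin 5) t) = v' ((![1, 2, 2] : Fin 3 → Fin 5) t) → u t v = u t v')
    (hw : ∀ t, ∀ v v' : Fin 5 → Fin 5, (∀ j, j ≠ (![0, 0, 1] : Fin 3 → Fin 5) t →
      j ≠ (![1, 2, 2] : Fin 3 → Fin 5) t → v j = v' j) → w t v = w t v')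
    (hind : ∃ a : Fin 5, α 0 a ≠ 0 ∧ ∀ c, c ≠ a → α 0 c = 0) :
    ¬ ∀ v : Fin 5 → Fin 5, (if Function.Injective v then (1 : ℂ) else 0) =
      (∑ k, α k (v ((![0, 1, 2] : Fin 3 → Fin 5) k)) * W k v) + ∑ t, u t v * w t v := by
  classical
  obtain ⟨a, -, hαoff⟩ := hind
  -- STEP 0′: the indicator complement
  let φ₀ : Fin 5 → ℂ := fun x => if x = a then (0 : ℂ) else 1
  have hφ₀α : ∑ c, φ₀ c * α 0 c = 0 := indicator_orthogonal a (α 0) hαoff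
  -- the constraint vectors contracted with `φ₀`
  let c0 : Fin 5 := 0
  let μ₁ : Fin 5 → ℂ := fun y => ∑ a, φ₀ a * u 0 (Function.update (Function.update (fun _ => c0) 0 a) 1 y)
  let μ₂ : Fin 5 → ℂ := fun y => ∑ a, φ₀ a * u 1 (Function.update (Function.update (fun _ => c0) 0 a) 2 y)
  let N : Fin 5 → Fin 5 → ℂ := fun y z =>
    ∑ x, φ₀ x * w 2 (Function.update (Function.update (Function.update (fun _ => c0) 0 x) 3 y) 4 z)
  -- φ₁ ∈ V₁ with the kernel-line property (CASE-2 kernel analysis)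
  obtain ⟨φ₁, wv, hφ₁β, hφ₁μ, hline⟩ := caseTwo_exists_phi1 a (α 1) μ₁
  -- φ₂ ∈ V₂ with two-slot form not proportional to `N` (REDUCTION)
  obtain ⟨φ₂, hφ₂γ, hφ₂μ, hnot⟩ := exists_orthogonal_not_proportional φ₀ φ₁ wv hline (α 2) μ₂ N
  -- the fibre-sum matrix of the chosen covectors
  let M : Fin 5 → Fin 5 → ℂ := fun x y =>
    ∑ σ : Equiv.Perm (Fin 5), if σ 3 = x ∧ σ 4 = y then φ₀ (σ 0) * φ₁ (σ 1) * φ₂ (σ 2) else 0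
  -- LEMMA C: covectors for the last two slots
  obtain ⟨φ₃, φ₄, hN0, hM0⟩ : ∃ φ₃ φ₄ : Fin 5 → ℂ, (∑ i, ∑ j, φ₃ i * N i j * φ₄ j) = 0 ∧
      (∑ i, ∑ j, φ₃ i * M i j * φ₄ j) ≠ 0 := by
    by_contra h
    push Not at h
    exact hnot (bilinear_proportional M N h)
  -- the witness
  let φ : Fin 5 → Fin 5 → ℂ := ![φ₀, φ₁, φ₂, φ₃, φ₄]
  have hφ0 : φ 0 = φ₀ := rfl
  have hφ1 : φ 1 = φ₁ := rfl
  have hφ2 : φ 2 = φ₂ := rfl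
  have hφ3 : φ 3 = φ₃ := rfl
  have hφ4 : φ 4 = φ₄ := rfl
  have hper : (Matrix.of fun c s => φ s c).permanent ≠ 0 := by
    rw [permanent_two_slot φ, hφ0, hφ1, hφ2, hφ3, hφ4]
    exact hM0
  refine LaplaceFiveSlices.refute_of_kills ![0, 1, 2] α W hW ![0, 0, 1] ![1, 2, 2] (by decide) u w hu hw
    ![false, false, true] ![1, 2, 4] ![0, 0, 0] ![0, 0, 0] ![0, 0, 3] ?_ ?_ φ hper ?_ ?_ ?_
  · intro t ht; fin_cases t
    · right; exact ⟨rfl, rfl⟩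
    · right; exact ⟨rfl, rfl⟩
    · exact absurd ht (by decide)
  · intro t ht; fin_cases t
    · exact absurd ht (by decide)
    · exact absurd ht (by decide)
    · decide
  · intro k; fin_cases k
    · exact hφ₀α
    · exact hφ₁β
    · exact hφ₂γ
  · intro t ht; fin_cases t
    · -- cut {0,1}, charged at slot 1
      show ∑ y, φ 1 y * ∑ a, φ 0 a * u 0 (Function.update (Function.update (fun _ => (0 : Fin 5)) 0 a) 1 y) = 0
      rw [hφ0, hφ1]; exact hφ₁μ
    · show ∑ y, φ 2 y * ∑ a, φ 0 a * u 1 (Function.update (Function.update (fun _ => (0 : Fin 5)) 0 a) 2 y) = 0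
      rw [hφ0, hφ2]; exact hφ₂μ
    · exact absurd ht (by decide)
  · intro t ht; fin_cases t
    · exact absurd ht (by decide)
    · exact absurd ht (by decide)
    · show ∑ z, φ 4 z * ∑ xy : Fin 5 × Fin 5, φ 0 xy.1 * φ 3 xy.2 *
          w 2 (Function.update (Function.update (Function.update (fun _ => (0 : Fin 5)) 0 xy.1) 3 xy.2) 4 z) = 0
      rw [hφ0, hφ3, hφ4, ← hN0]
      simp only [N, Fintype.sum_prod_type, Fin.sum_univ_five]
      ring

/-- **The «two inside + outside» configuration `(0; 01, 02, 34)`, CASE 2** (slice vector at slot `0` a letter indicator;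
the cut `{3,4}` is killed on its 2-slot side by the FIXED bilinear form `u₂`). [folklore] -/
theorem outside_case2 (α : Fin 3 → Fin 5 → ℂ) (W : Fin 3 → (Fin 5 → Fin 5) → ℂ)
    (hW : ∀ k, ∀ v v' : Fin 5 → Fin 5, (∀ j, j ≠ (![0, 1, 2] : Fin 3 → Fin 5) k → v j = v' j) → W k v = W k v')
    (u w : Fin 3 → (Fin 5 → Fin 5) → ℂ)
    (hu : ∀ t, ∀ v v' : Fin 5 → Fin 5, v ((![0, 0, 3] : Fin 3 → Fin 5) t) = v' ((![0, 0, 3] : Fin 3 → Fin 5) t) →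
      v ((![1, 2, 4] : Fin 3 → Fin 5) t) = v' ((![1, 2, 4] : Fin 3 → Fin 5) t) → u t v = u t v')
    (hw : ∀ t, ∀ v v' : Fin 5 → Fin 5, (∀ j, j ≠ (![0, 0, 3] : Fin 3 → Fin 5) t →
      j ≠ (![1, 2, 4] : Fin 3 → Fin 5) t → v j = v' j) → w t v = w t v')
    (hind : ∃ a : Fin 5, α 0 a ≠ 0 ∧ ∀ c, c ≠ a → α 0 c = 0) :
    ¬ ∀ v : Fin 5 → Fin 5, (if Function.Injective v then (1 : ℂ) else 0) =
      (∑ k, α k (v ((![0, 1, 2] : Fin 3 → Fin 5) k)) * W k v) + ∑ t, u t v * w t v := by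
  classical
  obtain ⟨a, -, hαoff⟩ := hind
  let φ₀ : Fin 5 → ℂ := fun x => if x = a then (0 : ℂ) else 1
  have hφ₀α : ∑ c, φ₀ c * α 0 c = 0 := indicator_orthogonal a (α 0) hαoff
  let c0 : Fin 5 := 0
  let μ₁ : Fin 5 → ℂ := fun y => ∑ a, φ₀ a * u 0 (Function.update (Function.update (fun _ => c0) 0 a) 1 y)
  let μ₂ : Fin 5 → ℂ := fun y => ∑ a, φ₀ a * u 1 (Function.update (Function.update (fun _ => c0) 0 a) 2 y)
  let N : Fin 5 → Fin 5 → ℂ := fun y z => u 2 (Function.update (Function.update (fun _ => c0) 3 y) 4 z)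
  obtain ⟨φ₁, wv, hφ₁β, hφ₁μ, hline⟩ := caseTwo_exists_phi1 a (α 1) μ₁
  obtain ⟨φ₂, hφ₂γ, hφ₂μ, hnot⟩ := exists_orthogonal_not_proportional φ₀ φ₁ wv hline (α 2) μ₂ N
  let M : Fin 5 → Fin 5 → ℂ := fun x y =>
    ∑ σ : Equiv.Perm (Fin 5), if σ 3 = x ∧ σ 4 = y then φ₀ (σ 0) * φ₁ (σ 1) * φ₂ (σ 2) else 0
  obtain ⟨φ₃, φ₄, hN0, hM0⟩ : ∃ φ₃ φ₄ : Fin 5 → ℂ, (∑ i, ∑ j, φ₃ i * N i j * φ₄ j) = 0 ∧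
      (∑ i, ∑ j, φ₃ i * M i j * φ₄ j) ≠ 0 := by
    by_contra h
    push Not at h
    exact hnot (bilinear_proportional M N h)
  let φ : Fin 5 → Fin 5 → ℂ := ![φ₀, φ₁, φ₂, φ₃, φ₄]
  have hφ0 : φ 0 = φ₀ := rfl
  have hφ1 : φ 1 = φ₁ := rfl
  have hφ2 : φ 2 = φ₂ := rfl
  have hφ3 : φ 3 = φ₃ := rfl
  have hφ4 : φ 4 = φ₄ := rfl
  have hper : (Matrix.of fun c s => φ s c).permanent ≠ 0 := by
    rw [permanent_two_slot φ, hφ0, hφ1, hφ2, hφ3, hφ4]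
    exact hM0
  refine LaplaceFiveSlices.refute_of_kills ![0, 1, 2] α W hW ![0, 0, 3] ![1, 2, 4] (by decide) u w hu hw
    ![false, false, false] ![1, 2, 4] ![0, 0, 3] ![0, 0, 0] ![0, 0, 0] ?_ ?_ φ hper ?_ ?_ ?_
  · intro t ht; fin_cases t
    · right; exact ⟨rfl, rfl⟩
    · right; exact ⟨rfl, rfl⟩
    · right; exact ⟨rfl, rfl⟩
  · intro t ht; fin_cases t
    · exact absurd ht (by decide)
    · exact absurd ht (by decide)
    · exact absurd ht (by decide)
  · intro k; fin_cases k
    · exact hφ₀α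
    · exact hφ₁β
    · exact hφ₂γ
  · intro t ht; fin_cases t
    · show ∑ y, φ 1 y * ∑ a, φ 0 a * u 0 (Function.update (Function.update (fun _ => (0 : Fin 5)) 0 a) 1 y) = 0
      rw [hφ0, hφ1]; exact hφ₁μ
    · show ∑ y, φ 2 y * ∑ a, φ 0 a * u 1 (Function.update (Function.update (fun _ => (0 : Fin 5)) 0 a) 2 y) = 0
      rw [hφ0, hφ2]; exact hφ₂μ
    · show ∑ y, φ 4 y * ∑ a, φ 3 a * u 2 (Function.update (Function.update (fun _ => (0 : Fin 5)) 3 a) 4 y) = 0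
      rw [hφ3, hφ4, ← hN0]
      simp only [N, Fin.sum_univ_five]
      ring
  · intro t ht; fin_cases t
    · exact absurd ht (by decide)
    · exact absurd ht (by decide)
    · exact absurd ht (by decide)

/-- **The «two inside + outside» configuration `(0; 01, 12, 34)` with slot `0` a leaf, CASE 2** (slice vector at slot `0`
a letter indicator; the cut `{1,2}` is charged at slot `2` against `φ₁`). [folklore] -/
theorem outside_leaf_case2 (α : Fin 3 → Fin 5 → ℂ) (W : Fin 3 → (Fin 5 → Fin 5) → ℂ)
    (hW : ∀ k, ∀ v v' : Fin 5 → Fin 5, (∀ j, j ≠ (![0, 1, 2] : Fin 3 → Fin 5) k → v j = v' j) → W k v = W k v')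
    (u w : Fin 3 → (Fin 5 → Fin 5) → ℂ)
    (hu : ∀ t, ∀ v v' : Fin 5 → Fin 5, v ((![0, 1, 3] : Fin 3 → Fin 5) t) = v' ((![0, 1, 3] : Fin 3 → Fin 5) t) →
      v ((![1, 2, 4] : Fin 3 → Fin 5) t) = v' ((![1, 2, 4] : Fin 3 → Fin 5) t) → u t v = u t v')
    (hw : ∀ t, ∀ v v' : Fin 5 → Fin 5, (∀ j, j ≠ (![0, 1, 3] : Fin 3 → Fin 5) t →
      j ≠ (![1, 2, 4] : Fin 3 → Fin 5) t → v j = v' j) → w t v = w t v')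
    (hind : ∃ a : Fin 5, α 0 a ≠ 0 ∧ ∀ c, c ≠ a → α 0 c = 0) :
    ¬ ∀ v : Fin 5 → Fin 5, (if Function.Injective v then (1 : ℂ) else 0) =
      (∑ k, α k (v ((![0, 1, 2] : Fin 3 → Fin 5) k)) * W k v) + ∑ t, u t v * w t v := by
  classical
  obtain ⟨a, -, hαoff⟩ := hind
  let φ₀ : Fin 5 → ℂ := fun x => if x = a then (0 : ℂ) else 1
  have hφ₀α : ∑ c, φ₀ c * α 0 c = 0 := indicator_orthogonal a (α 0) hαoff
  let c0 : Fin 5 := 0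
  let μ₁ : Fin 5 → ℂ := fun y => ∑ a, φ₀ a * u 0 (Function.update (Function.update (fun _ => c0) 0 a) 1 y)
  let N : Fin 5 → Fin 5 → ℂ := fun y z => u 2 (Function.update (Function.update (fun _ => c0) 3 y) 4 z)
  obtain ⟨φ₁, wv, hφ₁β, hφ₁μ, hline⟩ := caseTwo_exists_phi1 a (α 1) μ₁
  let μ₂ : Fin 5 → ℂ := fun y => ∑ a, φ₁ a * u 1 (Function.update (Function.update (fun _ => c0) 1 a) 2 y)
  obtain ⟨φ₂, hφ₂γ, hφ₂μ, hnot⟩ := exists_orthogonal_not_proportional φ₀ φ₁ wv hline (α 2) μ₂ N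
  let M : Fin 5 → Fin 5 → ℂ := fun x y =>
    ∑ σ : Equiv.Perm (Fin 5), if σ 3 = x ∧ σ 4 = y then φ₀ (σ 0) * φ₁ (σ 1) * φ₂ (σ 2) else 0
  obtain ⟨φ₃, φ₄, hN0, hM0⟩ : ∃ φ₃ φ₄ : Fin 5 → ℂ, (∑ i, ∑ j, φ₃ i * N i j * φ₄ j) = 0 ∧
      (∑ i, ∑ j, φ₃ i * M i j * φ₄ j) ≠ 0 := by
    by_contra h
    push Not at h
    exact hnot (bilinear_proportional M N h)
  let φ : Fin 5 → Fin 5 → ℂ := ![φ₀, φ₁, φ₂, φ₃, φ₄]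
  have hφ0 : φ 0 = φ₀ := rfl
  have hφ1 : φ 1 = φ₁ := rfl
  have hφ2 : φ 2 = φ₂ := rfl
  have hφ3 : φ 3 = φ₃ := rfl
  have hφ4 : φ 4 = φ₄ := rfl
  have hper : (Matrix.of fun c s => φ s c).permanent ≠ 0 := by
    rw [permanent_two_slot φ, hφ0, hφ1, hφ2, hφ3, hφ4]
    exact hM0
  refine LaplaceFiveSlices.refute_of_kills ![0, 1, 2] α W hW ![0, 1, 3] ![1, 2, 4] (by decide) u w hu hw
    ![false, false, false] ![1, 2, 4] ![0, 1, 3] ![0, 0, 0] ![0, 0, 0] ?_ ?_ φ hper ?_ ?_ ?_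
  · intro t ht; fin_cases t
    · right; exact ⟨rfl, rfl⟩
    · right; exact ⟨rfl, rfl⟩
    · right; exact ⟨rfl, rfl⟩
  · intro t ht; fin_cases t
    · exact absurd ht (by decide)
    · exact absurd ht (by decide)
    · exact absurd ht (by decide)
  · intro k; fin_cases k
    · exact hφ₀α
    · exact hφ₁β
    · exact hφ₂γ
  · intro t ht; fin_cases t
    · show ∑ y, φ 1 y * ∑ a, φ 0 a * u 0 (Function.update (Function.update (fun _ => (0 : Fin 5)) 0 a) 1 y) = 0
      rw [hφ0, hφ1]; exact hφ₁μ
    · show ∑ y, φ 2 y * ∑ a, φ 1 a * u 1 (Function.update (Function.update (fun _ => (0 : Fin 5)) 1 a) 2 y) = 0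
      rw [hφ1, hφ2]; exact hφ₂μ
    · show ∑ y, φ 4 y * ∑ a, φ 3 a * u 2 (Function.update (Function.update (fun _ => (0 : Fin 5)) 3 a) 4 y) = 0
      rw [hφ3, hφ4, ← hN0]
      simp only [N, Fin.sum_univ_five]
      ring
  · intro t ht; fin_cases t
    · exact absurd ht (by decide)
    · exact absurd ht (by decide)
    · exact absurd ht (by decide)

end LaplaceResidual

end Summit.ValiantsHypothesis.ValiantsHypothesis.Theorems.RigidityForcesSymmetryRankRigidMinimalRepr
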